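import Mathlib
import HarnessLib
import Summits.QuantumAdvantage.QuantumAdvantage.Theorems.PumpDialE

/-!
# PumpDial, part F (sections BaseKernel, PolyPump, Immunity) — support for item stmt-QuantumAdvantage-28487

Cell decomp-qadv, seat lens-4 («minimal counterexample / extremal reduction»), generation 25 — land port of the node
«PumpDial» (published under the cell's HOME/decomp-qadv-lens-4/g25/PumpDial.lean rev 3, sha256 59c460875773e61d…, record NODE-g25.md;
RESIDUAL MODE on AbsorptionDial:28487 `NoPerfectPolyOdd`).  The node file with ONLY the namespace renamed
`Theses.PumpDial → Theorems.PumpDial`, `example`s dropped and one-line docstrings added where missing, cut into chain-imported parts;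
the X-side junction theorems (conclusion `AbsorptionDial.NoPerfectPolyOdd` BY NAME) live in the LAST part, the only one importing
`Theses.AbsorptionDial`; every other part imports only `AdviceFreeQNC0.*`, `Literature.Computability.MetaComplexity.*`, HarnessLib, Mathlib
(no import path to any Theses file — checked on the tree's import lines), so route items can be typed BY NAME over these parts.
No `sorry`, no new axioms, no instances, no notation.

This part: `walkExp_two_table` … `not_endUnityAt_evenOff` (32 declarations).
-/

set_option autoImplicit false
set_option linter.dupNamespace false

noncomputable section

namespace Summit.QuantumAdvantage.QuantumAdvantage.Theorems.PumpDial
open Classical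
open Finset
open Summit.QuantumAdvantage.AdviceFreeQNC0
open Summit.QuantumAdvantage.AdviceFreeQNC0.TwoShot
open Summit.QuantumAdvantage.AdviceFreeQNC0.CharK
open Literature.Computability.MetaComplexity Literature.Computability.MetaComplexity.Smolensky

section BaseKernel

variable {K : Type*} [Field K]

/-! ## §16  BASE IN THE KERNEL — no constant unity on any K-hard board (descent to length 2)

The paper proof of NODE-g25 §4 is replaced by a shorter kernel argument that USES THE BOARD CALCULUS: the K-hard class
is closed under the degree-preserving restrictions R (odd diagonal `n+1 ↦ n`) and L3 (even off-diagonal `n+2 ↦ n`),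
so a constant unity on any K-hard board descends to a constant unity on `(2, 0)` or `(2, 1)`, and those two 3 × 4
linear systems are contradictory in every field (four inputs, `linear_combination`).  Hence `UnityBase` is a THEOREM
and the junction needs only `A_K` and `PUMP`: `closes_X'`, `closes_K'`, `closes_B'`. -/

/-- walk exponents of the four inputs of length 2 at the cuts 0, 1, 2 (kernel `decide`). -/
theorem walkExp_two_table :
    (walkExp (![false, false] : Fin 2 → Bool) 0 = 0 ∧ walkExp (![false, false] : Fin 2 → Bool) 1 = 0 ∧
      walkExp (![false, false] : Fin 2 → Bool) 2 = 0) ∧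
    (walkExp (![true, false] : Fin 2 → Bool) 0 = 1 ∧ walkExp (![true, false] : Fin 2 → Bool) 1 = 2 ∧
      walkExp (![true, false] : Fin 2 → Bool) 2 = 2) ∧
    (walkExp (![false, true] : Fin 2 → Bool) 0 = 1 ∧ walkExp (![false, true] : Fin 2 → Bool) 1 = 1 ∧
      walkExp (![false, true] : Fin 2 → Bool) 2 = 2) ∧
    (walkExp (![true, true] : Fin 2 → Bool) 0 = 2 ∧ walkExp (![true, true] : Fin 2 → Bool) 1 = 3 ∧
      walkExp (![true, true] : Fin 2 → Bool) 2 = 4) := by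
  decide

/-- a degree-0 cut function is a constant. -/
theorem exists_eq_const_of_deg_zero {m : ℕ} {P : CubeFn K m} (hP : P ∈ lowDeg K m 0) (u₀ : Fin m → Bool) :
    ∃ a : K, P = fun _ => a :=
  ⟨P u₀, funext fun u => by simpa using congrFun (eq_const_of_mem_lowDeg_zero hP u₀) u⟩

/-- no constant unity on the board `(2, 0)`. -/
theorem not_unityAt_two_zero : ¬ UnityAt K 2 0 0 := by
  rintro ⟨Y, hdeg, h1⟩
  have hdeg' : ∀ g : Fin 3, Y g ∈ lowDeg K 2 0 := hdeg
  have h1' : ∀ u, (∑ g : Fin 3, Y g u * liveInd K 0 g u) = 1 := h1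
  obtain ⟨l0, hl0⟩ := exists_eq_const_of_deg_zero (hdeg' 0) ![false, false]
  obtain ⟨l1, hl1⟩ := exists_eq_const_of_deg_zero (hdeg' 1) ![false, false]
  obtain ⟨l2, hl2⟩ := exists_eq_const_of_deg_zero (hdeg' 2) ![false, false]
  obtain ⟨⟨t00, t01, t02⟩, ⟨t10, t11, t12⟩, ⟨t20, t21, t22⟩, ⟨t30, t31, t32⟩⟩ := walkExp_two_table
  have e1 := h1' ![false, false]
  have e2 := h1' ![true, false]
  have e3 := h1' ![false, true]
  have e4 := h1' ![true, true]
  simp only [Fin.sum_univ_three, hl0, hl1, hl2, liveInd, Fin.val_zero, Fin.val_one, Fin.val_two,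
    t00, t01, t02, t10, t11, t12, t20, t21, t22, t30, t31, t32] at e1 e2 e3 e4
  norm_num at e1 e2 e3 e4
  have h10 : (1 : K) = 0 := by linear_combination (-1 : K) * e4 + 2 * e3 - e1 - e2
  exact one_ne_zero h10

/-- no constant unity on the board `(2, 1)`. -/
theorem not_unityAt_two_one : ¬ UnityAt K 2 1 0 := by
  rintro ⟨Y, hdeg, h1⟩
  have hdeg' : ∀ g : Fin 3, Y g ∈ lowDeg K 2 0 := hdeg
  have h1' : ∀ u, (∑ g : Fin 3, Y g u * liveInd K 1 g u) = 1 := h1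
  obtain ⟨l0, hl0⟩ := exists_eq_const_of_deg_zero (hdeg' 0) ![false, false]
  obtain ⟨l1, hl1⟩ := exists_eq_const_of_deg_zero (hdeg' 1) ![false, false]
  obtain ⟨l2, hl2⟩ := exists_eq_const_of_deg_zero (hdeg' 2) ![false, false]
  obtain ⟨⟨t00, t01, t02⟩, ⟨t10, t11, t12⟩, ⟨t20, t21, t22⟩, ⟨t30, t31, t32⟩⟩ := walkExp_two_table
  have e1 := h1' ![false, false]
  have e2 := h1' ![true, false]
  have e3 := h1' ![false, true]
  have e4 := h1' ![true, true]
  simp only [Fin.sum_univ_three, hl0, hl1, hl2, liveInd, Fin.val_zero, Fin.val_one, Fin.val_two,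
    t00, t01, t02, t10, t11, t12, t20, t21, t22, t30, t31, t32] at e1 e2 e3 e4
  norm_num at e1 e2 e3 e4
  have h10 : (1 : K) = 0 := by linear_combination (-1 : K) * e1 + 2 * e2 - e3 - e4
  exact one_ne_zero h10

/-- no constant unity on a K-hard board of length 2 (`c ≢ 2`). -/
theorem not_unityAt_two {c : ℕ} (hc : c % 3 ≠ 2) : ¬ UnityAt K 2 c 0 := by
  intro hU
  obtain h0 | h1 : c % 3 = 0 % 3 ∨ c % 3 = 1 % 3 := by omega
  · exact not_unityAt_two_zero (unityAt_charge_mod h0 hU)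
  · exact not_unityAt_two_one (unityAt_charge_mod h1 hU)

/-- `mod3_split` (PumpDial g25, section BaseKernel). -/
private theorem mod3_split {c m : ℕ} (h : c % 3 ≠ (m + 2) % 3) : c % 3 = (m + 1) % 3 ∨ c % 3 = m % 3 := by
  omega

/-- **BASE as a theorem**: no constant unity on ANY K-hard board of length `≥ 2` (descent by R and L3 to length 2). -/
theorem noConstantUnity : ∀ n c : ℕ, 2 ≤ n → KHard n c → ¬ UnityAt K n c 0 := by
  intro n
  induction n using Nat.strong_induction_on with
  | _ n ih =>
    intro c hn hK hU
    rcases hK with ⟨hodd, hdiag⟩ | ⟨heven, hoff⟩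
    · obtain ⟨m, rfl⟩ : ∃ m, n = m + 1 := ⟨n - 1, by omega⟩
      have hm2 : 2 ≤ m := by omega
      have hme : m % 2 = 0 := by omega
      have hoff' : (c + 1) % 3 ≠ m % 3 := by clear ih hU hodd hn hm2 hme; omega
      exact ih m (by omega) (c + 1) hm2 (Or.inr ⟨hme, hoff'⟩) (unityAt_restrict_diag' hdiag hU).1
    · obtain h2 | h4 : n = 2 ∨ 4 ≤ n := by omega
      · subst h2
        exact not_unityAt_two (by simpa using hoff) hU
      · obtain ⟨m, rfl⟩ : ∃ m, n = m + 2 := ⟨n - 2, by omega⟩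
        have hm2 : 2 ≤ m := by omega
        have hme : m % 2 = 0 := by omega
        rcases mod3_split hoff with hA | hB
        · have hoff' : (c + 1) % 3 ≠ m % 3 := by clear ih hU heven hoff hn h4 hm2 hme; omega
          exact ih m (by omega) (c + 1) hm2 (Or.inr ⟨hme, hoff'⟩) (unityAt_restrict_two_A hA hU)
        · have hoff' : (c + 1) % 3 ≠ m % 3 := by clear ih hU heven hoff hn h4 hm2 hme; omega
          exact ih m (by omega) (c + 1) hm2 (Or.inr ⟨hme, hoff'⟩) (unityAt_restrict_two_B hB hU)

/-- `BASE` holds (in fact on every K-hard board, not only `4 ≤ n ≤ 9`). -/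
theorem unityBase_holds : UnityBase := fun p _ _ n c hn _ hK => noConstantUnity n c (by omega) hK

/-- the K-level junction with BASE discharged: `PUMP ⟹ B_K`. -/
theorem closes_K' (hPump : UnityPump) : NoUnityHardOdd := closes_K unityBase_holds hPump

/-- `PUMP ⟹ B` (the X-implied Boolean piece of g24). -/
theorem closes_B' (hPump : UnityPump) : NoOneLiveHardOdd := closes_B unityBase_holds hPump

end BaseKernel

section PolyPump

variable {p : ℕ} [Fact p.Prime]

/-! ## §17  THE RIGHT-SIZED PUMP (rev 1): a polynomial gadget length already gives `B_K`

Critic c2 (66v45): `BASE ∧ PUMP` prove a LINEAR degree law where `B_K` needs only super-polylog.  The right-sized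
piece is `PolyPump k`: on a K-hard board with no degree-`d` unity, `6·(d+1)^k` MORE BITS admit no degree-`(d+1)`
unity (period 6 keeps the class).  For every FIXED `k` this yields `D(n) ≥ m` whenever `n ≥ 4 + 6·m^(k+1)`, i.e.
`D(n) ≳ (n/6)^(1/(k+1))`, still far above `(log₂ n)^C`: `closes_K_poly : PolyPump k → B_K`, `closes_X_poly :
A_K → PolyPump k → X`.  `PUMP ⟹ PolyPump 0` (`polyPump_zero_of_pump`); the data pump (period 6, +2 degrees) is the
case `k = 0` with room to spare.  A Smolensky / random-restriction style argument would naturally produce some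
`k ≥ 1`; any `k` closes the K-line below `A_K`. -/

/-- **piece `PolyPump k`** (single prime) [crux-candidate · UNDECIDED for every `k` · X-INCOMPARABLE · implied by
`PUMP` for `k = 0` · the natural output shape of a degree-lower-bound-by-gadget argument]. -/
def PolyPumpAt (p : ℕ) [Fact p.Prime] (k : ℕ) : Prop :=
  ∀ n c d : ℕ, 4 ≤ n → KHard n c → ¬ UnityAt (ZMod p) n c d →
    ¬ UnityAt (ZMod p) (n + 6 * (d + 1) ^ k) c (d + 1)

/-- `PolyPump k` for every prime `p ≥ 5`. -/
def PolyPump (k : ℕ) : Prop := ∀ (p : ℕ) [Fact p.Prime], 5 ≤ p → PolyPumpAt p k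

/-- `polyPumpAt_of_pump` (PumpDial g25, section PolyPump). -/
theorem polyPumpAt_of_pump (hP : UnityPumpAt p) : PolyPumpAt p 0 := by
  intro n c d hn hK hU h'
  simp only [pow_zero, mul_one] at h'
  exact hP n c d hn hK hU (unityAt_mono (ZMod p) (by omega) h')

/-- `polyPump_zero_of_pump` (PumpDial g25, section PolyPump). -/
theorem polyPump_zero_of_pump (hP : UnityPump) : PolyPump 0 := fun p _ hp => polyPumpAt_of_pump (hP p hp)

/-- `kHard_add_six_mul` (PumpDial g25, section PolyPump). -/
theorem kHard_add_six_mul {n c : ℕ} (t : ℕ) : KHard (n + 6 * t) c ↔ KHard n c := by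
  induction t with
  | zero => simp
  | succ t ih => rw [show n + 6 * (t + 1) = (n + 6 * t) + 6 by ring, kHard_add_six, ih]

/-- accumulated gadget length after `m` pumps: `Σ_{j<m} (j+1)^k`. -/
def gadgetSum (k m : ℕ) : ℕ := ∑ j ∈ Finset.range m, (j + 1) ^ k

/-- `gadgetSum_zero` (PumpDial g25, section PolyPump). -/
theorem gadgetSum_zero (k : ℕ) : gadgetSum k 0 = 0 := by simp [gadgetSum]

/-- `gadgetSum_succ` (PumpDial g25, section PolyPump). -/
theorem gadgetSum_succ (k m : ℕ) : gadgetSum k (m + 1) = gadgetSum k m + (m + 1) ^ k := by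
  simp [gadgetSum, Finset.sum_range_succ]

/-- `gadgetSum_le` (PumpDial g25, section PolyPump). -/
theorem gadgetSum_le (k m : ℕ) : gadgetSum k m ≤ m ^ (k + 1) := by
  unfold gadgetSum
  calc ∑ j ∈ Finset.range m, (j + 1) ^ k ≤ ∑ _j ∈ Finset.range m, m ^ k :=
        Finset.sum_le_sum fun j hj => Nat.pow_le_pow_left (by have := Finset.mem_range.1 hj; omega) k
    _ = m ^ (k + 1) := by rw [Finset.sum_const, Finset.card_range, smul_eq_mul, pow_succ']

/-- the ladder generated by `BASE` (a theorem) and `PolyPump k`: after `m` pumps, no degree-`m` unity. -/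
theorem polyPump_ladder {k : ℕ} (hP : PolyPumpAt p k) :
    ∀ m n c : ℕ, 4 ≤ n → KHard n c → ¬ UnityAt (ZMod p) (n + 6 * gadgetSum k m) c m := by
  intro m
  induction m with
  | zero =>
    intro n c hn hK
    rw [gadgetSum_zero, Nat.mul_zero, Nat.add_zero]
    exact noConstantUnity n c (by omega) hK
  | succ m ih =>
    intro n c hn hK
    have h := hP (n + 6 * gadgetSum k m) c m (by omega) ((kHard_add_six_mul _).2 hK) (ih n c hn hK)
    rw [gadgetSum_succ, Nat.mul_add, ← Nat.add_assoc]
    exact h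

/-- degree form: `n ≥ 4 + 6·m^(k+1)` ⟹ no degree-`m` unity on a K-hard board of length `n`. -/
theorem polyPump_degree {k : ℕ} (hP : PolyPumpAt p k) {m n c : ℕ} (hn : 4 + 6 * m ^ (k + 1) ≤ n)
    (hK : KHard n c) : ¬ UnityAt (ZMod p) n c m := by
  have hS := gadgetSum_le k m
  obtain ⟨n', rfl⟩ : ∃ n', n = n' + 6 * gadgetSum k m := ⟨n - 6 * gadgetSum k m, by omega⟩
  exact polyPump_ladder hP m n' c (by omega) ((kHard_add_six_mul _).1 hK)

/-- polynomial roots beat polylog: `4 + 6·((log₂ n)^C)^(k+1) ≤ n` eventually. -/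
theorem polylog_gadget_le (C k : ℕ) : ∃ n₀ : ℕ, ∀ n ≥ n₀, 4 + 6 * ((Nat.log 2 n) ^ C) ^ (k + 1) ≤ n := by
  obtain ⟨n₀, h₀⟩ := TubePlanProof.logPow_le_natSqrt (C * (k + 1))
  refine ⟨max n₀ 100, fun n hn => ?_⟩
  have h1 := h₀ n (le_trans (le_max_left _ _) hn)
  have h100 : 100 ≤ n := le_trans (le_max_right _ _) hn
  have hs : 10 ≤ Nat.sqrt n := Nat.le_sqrt.2 (by omega)
  have hss : Nat.sqrt n * Nat.sqrt n ≤ n := Nat.sqrt_le n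
  have h4 : 4 + 6 * Nat.sqrt n ≤ Nat.sqrt n * Nat.sqrt n := by nlinarith [hs]
  rw [← pow_mul]
  omega

/-- **`PolyPump k ⟹ B_K`** (single prime, odd diagonal class) … -/
theorem noUnityHard_of_polyPump {k : ℕ} (hP : PolyPumpAt p k) : NoUnityHardAt p := by
  intro C
  obtain ⟨n₀, h₀⟩ := polylog_gadget_le C k
  exact ⟨n₀, fun n hn c hH => polyPump_degree hP (h₀ n hn) (Or.inl hH)⟩

/-- … and on the even off-diagonal class. -/
theorem noUnityEven_of_polyPump {k : ℕ} (hP : PolyPumpAt p k) : NoUnityEvenAt p := by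
  intro C
  obtain ⟨n₀, h₀⟩ := polylog_gadget_le C k
  exact ⟨n₀, fun n hn c hE => polyPump_degree hP (h₀ n hn) (Or.inr hE)⟩

/-- **`PolyPump k → B_K`** for any fixed `k` (conclusion g24's crux BY NAME). -/
theorem closes_K_poly {k : ℕ} (hP : PolyPump k) : NoUnityHardOdd :=
  fun p _ hp => noUnityHard_of_polyPump (hP p hp)

/-- `PolyPump k → B` (the X-implied Boolean piece). -/
theorem closes_B_poly {k : ℕ} (hP : PolyPump k) : NoOneLiveHardOdd := bK_imp_b (closes_K_poly hP)

end PolyPump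

section Immunity

variable {K : Type*} [Field K] {n : ℕ}

/-! ## §18  THE MECHANISM EXHIBIT (rev 2): the immunity of `¬MOD₃` (Beck–Li 2013, Thm 5.2 — IN THE TREE) and the
END-CUT rung, PROVED

OBSERVATION.  On the even off-diagonal class the least unity degree found by exact elimination,
`D(m) = 2, 2, 3, 4, 4, 5` at `m = 4, 6, 8, 10, 12, 14`, and every certified structured upper bound above it,
`D(16) ≤ 6, D(18) ≤ 6, D(20) ≤ 7, D(22) ≤ 8`, equal `⌈m/3⌉ = ⌊(m+2)/3⌋` — EXACTLY the immunity of `¬χ₃` over a field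
of characteristic `∤ 3`: the least degree of a non-zero multilinear polynomial vanishing on a residue class
`{u : |u| ≡ r (mod 3)}` of `{0,1}^m` is `⌊(m+2)/3⌋` (Beck–Li, *Represent MOD function by low degree polynomial with
unbounded one-sided error*, arXiv:1304.0713, Thm 5.2; tree: `Smolensky.beckLi2013_thm52` / `…_attained`,
`Literature/Computability/MetaComplexity/NegModqImmunity.lean`, general shift form
`Smolensky.eq_zero_of_lowDegOn_of_forall_dvd_hwt`).
CONJECTURE «THIRD = IMMUNITY»: on even off-diagonal boards `D(m, c) = imm_{¬χ₃}(m) = ⌈m/3⌉` for every prime `p ≥ 5`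
(odd diagonal boards: the even number in `{⌈(m−1)/3⌉, ⌈(m−1)/3⌉ + 1}` by laws R/G/P).  This NAMES THE TOOL for
`PUMP` / `THIRD`: reduce a low-degree unity to a non-zero low-degree element of the ideal `⟨¬χ₃⟩` (polynomials
vanishing on a weight class mod 3) on `m − O(1)` of the bits, and cite Thm 5.2.
The END-CUT toy below IS that reduction in the simplest case, kernel-checked: a unity supported on the two end cuts
`{0, m}` of an off-diagonal board has degree `> (m−2)/3` over EVERY field of characteristic `≠ 3` — two applications
of Thm 5.2 (`Y₀ − 1` vanishes on the weight class where cut `m` is dead, so `Y₀ = 1`; then `Y_m` vanishes on the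
class where both end cuts are live, so `Y_m = 0`; then the class where cut `0` is dead is uncovered).  The constant
`1/3` of the data is the constant of the theorem. -/

/-- Beck–Li Thm 5.2, lower bound, shift form (tree `Smolensky.eq_zero_of_lowDegOn_of_forall_dvd_hwt`) specialised
to `q = 3` on `Fin n`: a polynomial of degree `t`, `3t + 2 ≤ n`, vanishing on a residue class of the Hamming weight
mod `3` is zero — over any field in which `3 ≠ 0`. -/
theorem immunity_mod3 (h3 : (3 : K) ≠ 0) {t s : ℕ} (ht : 3 * t + 2 ≤ n) {F : CubeFn K n}
    (hF : F ∈ lowDeg K n t) (hvan : ∀ u : Fin n → Bool, (wt u + s) % 3 = 0 → F u = 0) : F = 0 := by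
  have h3' : ((3 : ℕ) : K) ≠ 0 := by exact_mod_cast h3
  refine eq_zero_of_lowDegOn_of_forall_dvd_hwt h3' t s ?_ F (by rw [← lowDeg_eq_lowDegOn]; exact hF) ?_
  · intro ℓ hℓ
    refine ⟨ℓ + (3 - (ℓ + s) % 3) % 3, Nat.dvd_of_mod_eq_zero (by omega), by omega, ?_⟩
    rw [Fintype.card_fin]
    omega
  · intro x hx
    exact hvan x (Nat.mod_eq_zero_of_dvd hx)

/-- **`EndUnityAt K n c d`** — a unity SUPPORTED ON THE TWO END CUTS `0` and `n` (the toy of §18). -/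
def EndUnityAt (K : Type*) [Field K] (n c d : ℕ) : Prop :=
  ∃ Y₀ Y₁ : CubeFn K n, Y₀ ∈ lowDeg K n d ∧ Y₁ ∈ lowDeg K n d ∧
    ∀ u, Y₀ u * liveInd K c (0 : Fin (n + 1)) u + Y₁ u * liveInd K c (Fin.last n) u = 1

/-- an end-cut unity is a unity (all other cut functions zero): the toy is a SPECIAL CASE of `UnityAt`. -/
theorem unityAt_of_endUnityAt {c d : ℕ} (h : EndUnityAt K n c d) : UnityAt K n c d := by
  obtain ⟨Y₀, Y₁, h₀, h₁, h1⟩ := h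
  refine ⟨fun g => (if g = 0 then Y₀ else 0) + (if g = Fin.last n then Y₁ else 0), fun g => ?_, fun u => ?_⟩
  · refine Submodule.add_mem _ ?_ ?_
    · by_cases hg : g = 0
      · rw [if_pos hg]; exact h₀
      · rw [if_neg hg]; exact Submodule.zero_mem _
    · by_cases hg : g = Fin.last n
      · rw [if_pos hg]; exact h₁
      · rw [if_neg hg]; exact Submodule.zero_mem _
  · have e := h1 u
    simp only [Pi.add_apply, add_mul, Finset.sum_add_distrib, ite_apply, Pi.zero_apply, ite_mul, zero_mul,
      Finset.sum_ite_eq', Finset.mem_univ, if_true]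
    exact e

/-- on a DIAGONAL board (`c ≡ n`) there is no end-cut unity of any degree: the weight class `|u| ≡ −c` kills both
end cuts (any field). -/
theorem not_endUnityAt_diag {c d : ℕ} (hc : c % 3 = n % 3) (hn : 2 ≤ n) : ¬ EndUnityAt K n c d := by
  rintro ⟨Y₀, Y₁, -, -, h1⟩
  obtain ⟨T, -, hT⟩ := Finset.exists_subset_card_eq (s := (Finset.univ : Finset (Fin n)))
    (show (3 - c % 3) % 3 ≤ (Finset.univ : Finset (Fin n)).card by
      rw [Finset.card_univ, Fintype.card_fin]; omega)
  have hw : wt (indVec T) = (3 - c % 3) % 3 := by rw [← hT]; exact hwt_indVec T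
  have e := h1 (indVec T)
  have L0 : liveInd K c (0 : Fin (n + 1)) (indVec T) = 0 := by
    simp only [liveInd, Fin.val_zero, walkExp, Summit.QuantumAdvantage.AdviceFreeQNC0.TransferWalk.wtPrefix_zero, Nat.add_zero, hw]
    rw [if_neg (by omega)]
  have L1 : liveInd K c (Fin.last n) (indVec T) = 0 := by
    simp only [liveInd, Fin.val_last, walkExp_at_last, hw]
    rw [if_neg (by omega)]
  rw [L0, L1, mul_zero, mul_zero, add_zero] at e
  exact zero_ne_one e

/-- **END-CUT RUNG (PROVED; mechanism = Beck–Li immunity of `¬χ₃`)**: over a field with `3 ≠ 0`, an OFF-DIAGONAL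
board `(n, c)` (`c ≢ n (mod 3)` — in particular every even K-hard board) carries NO unity supported on the end cuts
`{0, n}` of degree `d` with `3d + 2 ≤ n`.  Two applications of Thm 5.2 and one uncovered weight class. -/
theorem not_endUnityAt (h3 : (3 : K) ≠ 0) {c d : ℕ} (hc : c % 3 ≠ n % 3) (hd : 3 * d + 2 ≤ n) :
    ¬ EndUnityAt K n c d := by
  rintro ⟨Y₀, Y₁, h₀, h₁, h1⟩
  have L0 : ∀ u : Fin n → Bool, liveInd K c (0 : Fin (n + 1)) u = if (c + wt u) % 3 ≠ 0 then 1 else 0 := by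
    intro u
    simp only [liveInd, Fin.val_zero, walkExp, Summit.QuantumAdvantage.AdviceFreeQNC0.TransferWalk.wtPrefix_zero, Nat.add_zero]
  have L1 : ∀ u : Fin n → Bool,
      liveInd K c (Fin.last n) u = if (c + n + 2 * wt u) % 3 ≠ 0 then 1 else 0 := by
    intro u
    simp only [liveInd, Fin.val_last, walkExp_at_last]
  -- step 1: `Y₀ − 1` vanishes on the weight class `|u| ≡ c + n` (cut `n` dead, cut `0` live), hence `Y₀ = 1`
  have hY0 : Y₀ - 1 = 0 := by
    refine immunity_mod3 h3 (s := 2 * (c + n)) hd (Submodule.sub_mem _ h₀ ?_) fun u hu => ?_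
    · rw [← mono_empty]; exact mono_mem_lowDeg (by simp)
    · have e := h1 u
      rw [L0, L1, if_pos (by omega), if_neg (by omega), mul_one, mul_zero, add_zero] at e
      rw [Pi.sub_apply, Pi.one_apply, e, sub_self]
  have hY0' : ∀ u, Y₀ u = 1 := fun u => by
    have := congrFun hY0 u
    rwa [Pi.sub_apply, Pi.one_apply, Pi.zero_apply, sub_eq_zero] at this
  -- step 2: `Y₁` vanishes on the weight class `|u| ≡ −n` (both end cuts live), hence `Y₁ = 0`
  have hY1 : Y₁ = 0 := by
    refine immunity_mod3 h3 (s := n) hd h₁ fun u hu => ?_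
    have e := h1 u
    rw [L0, L1, if_pos (by omega), if_pos (by omega), hY0', one_mul, mul_one] at e
    linear_combination e
  -- step 3: the weight class `|u| ≡ −c` (cut `0` dead) is uncovered
  obtain ⟨T, -, hT⟩ := Finset.exists_subset_card_eq (s := (Finset.univ : Finset (Fin n)))
    (show (3 - c % 3) % 3 ≤ (Finset.univ : Finset (Fin n)).card by
      rw [Finset.card_univ, Fintype.card_fin]; omega)
  have hw : wt (indVec T) = (3 - c % 3) % 3 := by rw [← hT]; exact hwt_indVec T
  have e := h1 (indVec T)
  rw [L0, hw, if_neg (by omega), hY1, mul_zero, Pi.zero_apply, zero_mul, add_zero] at e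
  exact zero_ne_one e

/-- the rung on the even K-hard class: no end-cut unity of degree `d ≤ (n − 2)/3` (every field with `3 ≠ 0`). -/
theorem not_endUnityAt_evenOff (h3 : (3 : K) ≠ 0) {c d : ℕ} (hE : EvenOff n c) (hd : 3 * d + 2 ≤ n) :
    ¬ EndUnityAt K n c d :=
  not_endUnityAt h3 hE.2 hd

end Immunity

end Summit.QuantumAdvantage.QuantumAdvantage.Theorems.PumpDial
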